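import Mathlib
import Summits.NavierStokesRegularity.FluidComputer.TransportGalerkinLevelExistence
import Summits.NavierStokesRegularity.FluidComputer.TransportGalerkinAbcH2
import HarnessLib

/-!
# Galerkin limit of the transport model, XVI: the forced-ABC KEEP from the certificates and the X0 row ALONE (instab g19, cell `ns-blowup`, 2026-08-27)

HONEST FRAMING (human ruling D-0035): nothing here is a claim about Navier–Stokes blow-up.
WHAT THIS IS NOT: not NS — a MODEL theorem schema about the forced-ABC perturbation equation on
`𝕋³`; its load-bearing inputs are the Lyapunov certificates of record (interval stage not
commissioned) and the certified X0 eigenvalue; no number or census word moves.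

PURPOSE. The end of instab g19's residence programme. `TransportGalerkinAbcH2.exists_keep_eigenvector_abc_of_levels`
reads KEEP from the certificates, the X0 row and the Galerkin levels of the seed as `C¹` solutions of
the finite-dimensional ODE keeping the linear clauses; part XV (`TransportGalerkinLevelExistence.exists_level_solution`)
constructs those levels. Composed (`exists_keep_eigenvector_abc_final`): from
`Torus.IsLinNSEigenvalue ν (abcFlow A B C) μ` (`μ ≥ 0`, `ν > 0`) there is the eigenvector `v` of the
X0 door, and for EVERY choice of window `T`, amplitude `ε > 0`, certificate objects and inequalities
at levels `≥ K` (g18's list verbatim), gap `ω < 2μ`, margin `C'` and window condition, EVERY true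
solution `w` of the model from `ε•v` read in the class with a uniform polynomial tail of scaled order
`6` (and the clauses) obeys `ε e^{μt}/2 ≤ ‖w t‖` while `ε e^{μt} ≤ 2/(9C')`.
NO residence, NO box, NO radii, NO `H²` bound, NO Galerkin data among the hypotheses:
`HOME/instab/BETA2-SPEC.md` §6 («engine class M–L, not owned») is discharged in the kernel.
-/

noncomputable section

open scoped ENNReal NNReal ComplexConjugate InnerProductSpace
open Set Filter Topology

namespace Summit.NavierStokesRegularity.FluidComputer.TransportGalerkinAbcFinal

open RCLike MeasureTheory UnitAddTorus
open Literature.Analysis.FunctionSpaces Literature.Analysis.FunctionSpaces.Lattice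
open Literature.Analysis.FunctionSpaces.Torus Literature.Analysis.FunctionSpaces.EuclideanSpace
open Literature.Analysis.ODE Literature.Analysis.FluidPDE
open Summit.NavierStokesRegularity.FluidComputer.TransportGalerkin
open Summit.NavierStokesRegularity.FluidComputer.TransportGalerkinBox
open Summit.NavierStokesRegularity.FluidComputer.TransportGalerkinEigen
open Summit.NavierStokesRegularity.FluidComputer.TransportGalerkinAbc
open Summit.NavierStokesRegularity.FluidComputer.TransportGalerkinInvariance
open Summit.NavierStokesRegularity.FluidComputer.TransportGalerkinLevelSubspace
open Summit.NavierStokesRegularity.FluidComputer.TransportGalerkinLevelExistence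
open Summit.NavierStokesRegularity.FluidComputer.TransportGalerkinAbcH2

/-- The truncated seed `P_N (ε • v)` of a constrained `v` lies in the constrained level `S_N`. -/
theorem cubeProj_smul_mem_levelSubspace {v : lp (fun _ : (Fin 3 → ℤ) => EuclideanSpace ℂ (Fin 3)) 2}
    (hvP : ∀ k, lerayCLM k (v k) = v k)
    (hvreal : ∀ (j : Fin 3) (k : Fin 3 → ℤ), (EuclideanSpace.proj j : EuclideanSpace ℂ (Fin 3) →L[ℂ] ℂ) (v (-k)) =
      conj ((EuclideanSpace.proj j : EuclideanSpace ℂ (Fin 3) →L[ℂ] ℂ) (v k)))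
    (hvdiv : ∀ k : Fin 3 → ℤ, ∑ j, ((k j : ℤ) : ℂ) * (EuclideanSpace.proj j : EuclideanSpace ℂ (Fin 3) →L[ℂ] ℂ) (v k) = 0)
    (ε : ℝ) (N : ℕ) : cubeProj N (ε • v) ∈ levelSubspace N := by
  have hz : ε • v ∈ box (fun k => |ε| * ‖(v : (Fin 3 → ℤ) → EuclideanSpace ℂ (Fin 3)) k‖)
      (fun j => (EuclideanSpace.proj j : EuclideanSpace ℂ (Fin 3) →L[ℂ] ℂ)) lerayCLM :=
    smul_mem_box hvP hvreal hvdiv fun k => le_rfl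
  have h := cubeProj_mem_box hz N
  exact ⟨lpProj_idem _ _, h.2.1, h.2.2.1, h.2.2.2⟩

/-- **KEEP for the forced-ABC model from the certificates and the X0 row alone**
(`exists_keep_eigenvector_abc_final`; see the module docstring). -/
theorem exists_keep_eigenvector_abc_final (K : ℕ) (A B C : ℝ) {ν μ : ℝ} (hν : 0 < ν) (hμ : 0 ≤ μ)
    (heig : Torus.IsLinNSEigenvalue ν (Torus.abcFlow A B C) (μ : ℂ)) :
    ∃ v : lp (fun _ : (Fin 3 → ℤ) => EuclideanSpace ℂ (Fin 3)) 2,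
      ‖v‖ = 1 ∧ RapidDecay (⇑v) ∧ (∀ k, lerayCLM k (v k) = v k) ∧
      (∀ (j : Fin 3) (k : Fin 3 → ℤ), (EuclideanSpace.proj j : EuclideanSpace ℂ (Fin 3) →L[ℂ] ℂ) (v (-k)) =
        conj ((EuclideanSpace.proj j : EuclideanSpace ℂ (Fin 3) →L[ℂ] ℂ) (v k))) ∧
      (∀ k : Fin 3 → ℤ, ∑ j, ((k j : ℤ) : ℂ) * (EuclideanSpace.proj j : EuclideanSpace ℂ (Fin 3) →L[ℂ] ℂ) (v k) = 0) ∧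
      linOp ν (mFourierCoeff (complexify ∘ Torus.abcFlow A B C))
          (fun j => (EuclideanSpace.proj j : EuclideanSpace ℂ (Fin 3) →L[ℂ] ℂ)) lerayCLM v = μ • v ∧
      ∀ {T : ℝ} (hT : 0 ≤ T) {ε : ℝ} (hε : 0 < ε)
        {μt : ℝ}
        {G₁ G₂ G : lp (fun _ : (Fin 3 → ℤ) => EuclideanSpace ℂ (Fin 3)) 2 →L[ℝ]
          lp (fun _ : (Fin 3 → ℤ) => EuclideanSpace ℂ (Fin 3)) 2}
        (hG₁ : ∀ x y : lp (fun _ : (Fin 3 → ℤ) => EuclideanSpace ℂ (Fin 3)) 2, ⟪G₁ x, y⟫_ℂ = ⟪x, G₁ y⟫_ℂ)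
        (hG₂ : ∀ x y : lp (fun _ : (Fin 3 → ℤ) => EuclideanSpace ℂ (Fin 3)) 2, ⟪G₂ x, y⟫_ℂ = ⟪x, G₂ y⟫_ℂ)
        (hG : ∀ x y : lp (fun _ : (Fin 3 → ℤ) => EuclideanSpace ℂ (Fin 3)) 2, ⟪G x, y⟫_ℂ = ⟪x, G y⟫_ℂ)
        (hG₁P : ∀ n, ∀ w z : lp (fun _ : (Fin 3 → ℤ) => EuclideanSpace ℂ (Fin 3)) 2,
          ⟪G₁ w, cubeProj (n + K) z⟫_ℂ = ⟪G₁ (cubeProj (n + K) w), z⟫_ℂ)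
        (hG₂P : ∀ n, ∀ w z : lp (fun _ : (Fin 3 → ℤ) => EuclideanSpace ℂ (Fin 3)) 2,
          ⟪G₂ w, cubeProj (n + K) z⟫_ℂ = ⟪G₂ (cubeProj (n + K) w), z⟫_ℂ)
        (hGP : ∀ n, ∀ w z : lp (fun _ : (Fin 3 → ℤ) => EuclideanSpace ℂ (Fin 3)) 2,
          ⟪G w, cubeProj (n + K) z⟫_ℂ = ⟪G (cubeProj (n + K) w), z⟫_ℂ)
        (hG₁pos : ∀ x : lp (fun _ : (Fin 3 → ℤ) => EuclideanSpace ℂ (Fin 3)) 2, 0 ≤ re ⟪G₁ x, x⟫_ℂ)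
        {ω c m₂ M₁ : ℝ} (hc : 0 < c) (hm₂ : 0 < m₂) (hM₁ : 0 ≤ M₁)
        (hm₂' : ∀ x : lp (fun _ : (Fin 3 → ℤ) => EuclideanSpace ℂ (Fin 3)) 2, m₂ * ‖x‖ ^ 2 ≤ re ⟪G₂ x, x⟫_ℂ)
        (hM₁' : ∀ x : lp (fun _ : (Fin 3 → ℤ) => EuclideanSpace ℂ (Fin 3)) 2,
          re ⟪G₁ x, x⟫_ℂ ≤ M₁ * (eNormSq (-1) (⇑x)).toReal)
        {m M ω₁ : ℝ} (hm0 : 0 < m)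
        (hm : ∀ x : lp (fun _ : (Fin 3 → ℤ) => EuclideanSpace ℂ (Fin 3)) 2, m * ‖x‖ ^ 2 ≤ re ⟪G x, x⟫_ℂ)
        (hM : ∀ x : lp (fun _ : (Fin 3 → ℤ) => EuclideanSpace ℂ (Fin 3)) 2, re ⟪G x, x⟫_ℂ ≤ M * ‖x‖ ^ 2)
        (h₁ : ∀ n, ∀ w : lp (fun _ : (Fin 3 → ℤ) => EuclideanSpace ℂ (Fin 3)) 2,
          2 * re ⟪G₁ (cubeProj (n + K) w), linOp ν (mFourierCoeff (EuclideanSpace.complexify ∘ Torus.abcFlow A B C))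
            (fun j => (EuclideanSpace.proj j : EuclideanSpace ℂ (Fin 3) →L[ℂ] ℂ)) lerayCLM (cubeProj (n + K) w)⟫_ℂ +
            c * re ⟪G₂ (cubeProj (n + K) w), cubeProj (n + K) w⟫_ℂ ≤ 2 * ω * re ⟪G₁ (cubeProj (n + K) w), cubeProj (n + K) w⟫_ℂ)
        (h₂ : ∀ n, ∀ w : lp (fun _ : (Fin 3 → ℤ) => EuclideanSpace ℂ (Fin 3)) 2,
          re ⟪G₂ (cubeProj (n + K) w), linOp ν (mFourierCoeff (EuclideanSpace.complexify ∘ Torus.abcFlow A B C))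
            (fun j => (EuclideanSpace.proj j : EuclideanSpace ℂ (Fin 3) →L[ℂ] ℂ)) lerayCLM (cubeProj (n + K) w)⟫_ℂ ≤
            ω * re ⟪G₂ (cubeProj (n + K) w), cubeProj (n + K) w⟫_ℂ)
        (hL : ∀ n, ∀ w : lp (fun _ : (Fin 3 → ℤ) => EuclideanSpace ℂ (Fin 3)) 2,
          re ⟪G (cubeProj (n + K) w), linOp ν (mFourierCoeff (EuclideanSpace.complexify ∘ Torus.abcFlow A B C))
            (fun j => (EuclideanSpace.proj j : EuclideanSpace ℂ (Fin 3) →L[ℂ] ℂ)) lerayCLM (cubeProj (n + K) w)⟫_ℂ ≤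
            ω₁ * re ⟪G (cubeProj (n + K) w), cubeProj (n + K) w⟫_ℂ)
        (hμ₁ : μt ≤ ω₁) (hμ₂ : μt ≤ ω)
        (htail : ∀ n, ∀ q : lp (fun _ : (Fin 3 → ℤ) => EuclideanSpace ℂ (Fin 3)) 2, cubeProj (n + K) q = 0 →
          2 * μt * re ⟪G₁ q, q⟫_ℂ + c * re ⟪G₂ q, q⟫_ℂ ≤ 2 * ω * re ⟪G₁ q, q⟫_ℂ)
        (hgap : ω < 2 * μ)
        {C' : ℝ}
        (hCC' : Real.sqrt (M₁ / (c * m₂)) * (2 * ((Fintype.card (Fin 3) : ℝ) * (2 * Real.pi)) *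
            Real.sqrt ((∑' l : Fin 3 → ℤ, ENNReal.ofReal (sobolevWeight (-2) l ^ 2)).toReal)) *
            Real.sqrt (Real.pi / (2 * μ - ω)) < C')
        (hsmall : ∀ t ∈ Icc 0 T, C' * (3 / 2 : ℝ) ^ 2 * (ε * Real.exp (μ * t)) < 3 / 2 - 1)
        -- the true solution, in the class with a uniform polynomial tail of scaled order 6
        {w : ℝ → lp (fun _ : (Fin 3 → ℤ) => EuclideanSpace ℂ (Fin 3)) 2} (hw : ContinuousOn w (Icc 0 T))
        (hw0 : w 0 = ε • v)
        (hw' : ∀ t ∈ Ioo 0 T, HasDerivAt w (nsField ν (mFourierCoeff (EuclideanSpace.complexify ∘ Torus.abcFlow A B C))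
          (fun j => (EuclideanSpace.proj j : EuclideanSpace ℂ (Fin 3) →L[ℂ] ℂ)) lerayCLM (w t)) t)
        {Cw : ℝ} (hCw : 0 ≤ Cw)
        (hwdec : ∀ t ∈ Icc 0 T, ∀ k, ‖(w t : (Fin 3 → ℤ) → EuclideanSpace ℂ (Fin 3)) k‖ ≤
          Cw * sobolevWeight (-((Fintype.card (Fin 3) : ℝ) + 3)) k)
        (hwfix : ∀ t ∈ Icc 0 T, ∀ k, lerayCLM k ((w t : (Fin 3 → ℤ) → EuclideanSpace ℂ (Fin 3)) k) =
          (w t : (Fin 3 → ℤ) → EuclideanSpace ℂ (Fin 3)) k)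
        (hwreal : ∀ t ∈ Icc 0 T, ∀ (j : Fin 3) (k : Fin 3 → ℤ),
          (EuclideanSpace.proj j : EuclideanSpace ℂ (Fin 3) →L[ℂ] ℂ) ((w t : (Fin 3 → ℤ) → EuclideanSpace ℂ (Fin 3)) (-k)) =
            conj ((EuclideanSpace.proj j : EuclideanSpace ℂ (Fin 3) →L[ℂ] ℂ) ((w t : (Fin 3 → ℤ) → EuclideanSpace ℂ (Fin 3)) k)))
        (hwdiv : ∀ t ∈ Icc 0 T, ∀ k : Fin 3 → ℤ,
          ∑ j, ((k j : ℤ) : ℂ) * (EuclideanSpace.proj j : EuclideanSpace ℂ (Fin 3) →L[ℂ] ℂ)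
            ((w t : (Fin 3 → ℤ) → EuclideanSpace ℂ (Fin 3)) k) = 0)
        {t : ℝ} (ht : t ∈ Icc 0 T) (hχ : ε * Real.exp (μ * t) ≤ 2 / (9 * C')),
        ε * Real.exp (μ * t) / 2 ≤ ‖w t‖ := by
  obtain ⟨v, hv1, hvr, hvP, hvreal, hvdiv, hAv, H⟩ :=
    exists_keep_eigenvector_abc_of_levels K A B C hν hμ heig
  refine ⟨v, hv1, hvr, hvP, hvreal, hvdiv, hAv, ?_⟩
  intro T hT ε hε μt G₁ G₂ G hG₁ hG₂ hG hG₁P hG₂P hGP hG₁pos ω c m₂ M₁ hc hm₂ hM₁ hm₂' hM₁' m M ω₁ hm0 hm hM h₁ h₂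
    hL hμ₁ hμ₂ htail hgap C' hCC' hsmall w hw hw0 hw' Cw hCw hwdec hwfix hwreal hwdiv t ht hχ
  -- the Galerkin levels of the seed: constructed
  have hUreal : IsConjSymm (mFourierCoeff (EuclideanSpace.complexify ∘ Torus.abcFlow A B C)) :=
    (isConjSymm_iff_proj _).2 (abcHost_real A B C)
  have hsol := fun n => exists_level_solution (ν := ν) hν.le (rapidDecay_abcHost A B C) hUreal (abcHost_div A B C)
    (n + K) (cubeProj_smul_mem_levelSubspace hvP hvreal hvdiv ε (n + K))
  choose u hu0 hu' hucont humem using hsol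
  exact H hT hε (u := u)
    (fun n t ht => (hu' n T t ht).continuousWithinAt)
    (fun n => hu0 n)
    (fun n t ht => hu' n T t ht)
    (fun n => hucont n T)
    (fun n t _ => (humem n t).1)
    (fun n t _ => (humem n t).2.1)
    (fun n t _ => (humem n t).2.2.1)
    (fun n t _ => (humem n t).2.2.2)
    hG₁ hG₂ hG hG₁P hG₂P hGP hG₁pos hc hm₂ hM₁ hm₂' hM₁' hm0 hm hM h₁ h₂ hL hμ₁ hμ₂ htail hgap hCC' hsmall hw hw0
    hw' hCw hwdec hwfix hwreal hwdiv ht hχ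

end Summit.NavierStokesRegularity.FluidComputer.TransportGalerkinAbcFinal

end
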